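import Summits.ABC.IUTFork.LDHCor312Primes
import Summits.ABC.IUTFork.Cor312FormsBridge
import HarnessLib

/-!
# The fork at [IUTchIII] Corollary 3.12 — the verbatim form and the Dupuy–Hilado form OVER ANY FINITE PRIME SET

Record-only file (D-0012) of the abc-iut cell (Cor. 3.12 sub-crew, wave 2, seat abc-iut-c312-6, board row W2-C′);
TAKES NO SIDE. Theorems only. `Cor312FormsBridge` bridges c312-7's PRINTED statement `Cor312.Setting.Statement` and
c312-3's `DHData.Cor312DH` — Dupuy–Hilado (1.1) "`−deĝ̲(P_q) ≤ ln ν̄_𝕃(hull(U_Θ))`" TRUNCATED to the datum's prime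
set `T` (the STRONGEST truncation: RQ7 finding R7-C3-F1, seat abc-iut-L6-t24; repaired by c312-3's companion
`LDHCor312Primes`: `Cor312DHOn T'` for every finite prime set `T' ⊇ T`, monotone in `T'`, `Cor312DHLim` = (1.1)
read with `Σ_p` over all primes, `HullSupportedOn T₀` = the hull components have zero log-volume off `T₀`).
Propagation (ii) of L6-t24's closure note (INBOX 2026-08-25T21:10:49Z: the verbatim ↔ DH identification "should
now name WHICH truncation it identifies the verbatim `−|log(Θ)|` with") in the ONE-DIRECTIONAL shape of
`Cor312FormsBridge.cor312DH_of_statement_of_le` (no `BridgeHyps`, no equality of hull-volumes):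

* `cor312DHOn_of_statement_of_le`: for any finite prime set `T' ⊇ T`, if c312-7's `−|log(Θ)|` is at most
  `[F:ℚ]·ln ν̄_{𝕃,T'}(hull(U_Θ))` and the `q`-sides agree (`−|log(q)| = [F:ℚ]·ln ν̄_𝕃(O_𝕃(−P_q)) = −deĝ(P_q)`, a
  `T'`-independent number: `DHData.negAbsLogqDHOn_eq`), then the printed statement implies `Cor312DHOn T'`,
  hence (1.1) with `Σ_p` (`cor312DHLim_of_statement_of_le`);
* `statement_of_cor312DHOn_of_le`: conversely under the opposite inequality and finiteness;
* `…_norm` versions (§ Normalized scale): the same bridges with `P` compared DIRECTLY to DH's normalized numbers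
  (no `[F:ℚ]`), the right scale for provenance-attached settings (RQ finding N-C8-1, seat c312-8);
* `cor312DHOn_of_statement_of_le_of_subset` (monotonicity in the prime set) and
  `le_negLogThetaDHOn_iff_of_hullSupportedOn`: with the hull supported on `T₀`, the comparison hypothesis is the
  same over every `T' ⊇ T₀` — the truncation to name is `T₀` (`negLogThetaDHOn_eq_of_hullSupportedOn`).

[claim: Mochizuki2012, status: disputed] [cite: DupuyHilado2025, §1 (1.1) pp. 3–4, Thm. 3.10.1]
Deliberately NOT here: which inequality a real instance satisfies (the coarse-vs-fine question of R7-C3-N3), any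
archimedean contribution (`p = ∞` is out of DH's `ln ν̄_𝕃`), any judgement.
-/

noncomputable section

namespace Summit.ABC

namespace IUTFork

namespace Cor312Vol

open Thm311 Cor312 Literature.IUT.LogVolume

variable {T : ThetaIndex} {S : Situation T} {P : Cor312.Setting S}
variable {F : Type} [Field F] [NumberField F]

/-- The `q`-side over any prime set `T' ⊇ T` is the `q`-side over `T` (both are `−deĝ̲(P_q)`, Dupuy–Hilado
Thm. 3.10.1). [cite: DupuyHilado2025, Thm. 3.10.1] -/
theorem negAbsLogqDHOn_eq_negAbsLogqDH (D : DHData F) {T' : Finset ℕ} (hT' : ∀ p ∈ T', p.Prime)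
    (hT : D.T ⊆ T') : D.negAbsLogqDHOn T' = D.negAbsLogqDH := by
  rw [D.negAbsLogqDHOn_eq hT' hT, ← D.negAbsLogqDHOn_self, D.negAbsLogqDHOn_eq D.T_prime le_rfl]

/-- **Printed statement ⟹ (1.1) truncated to `T'`, one-directional**: for a finite prime set `T' ⊇ T`, if
c312-7's `−|log(Θ)|` is AT MOST `[F:ℚ]·ln ν̄_{𝕃,T'}(hull(U_Θ))` and the two `−|log(q)|` agree up to `[F:ℚ]`, then
`P.Statement → D.Cor312DHOn T'`. This is the shape in which the verbatim number can honestly be compared with a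
DH datum whose hull has contributions off the minimal `T` (R7-C3-F1). [cite: DupuyHilado2025, §1 (1.1)] -/
theorem cor312DHOn_of_statement_of_le (D : DHData F) {T' : Finset ℕ} (hT' : ∀ p ∈ T', p.Prime)
    (hT : D.T ⊆ T')
    (hΘ : P.negLogTheta ≤ (((Module.finrank ℚ F : ℝ) * D.negLogThetaDHOn T' : ℝ) : WithTop ℝ))
    (hq : P.negLogQ = (Module.finrank ℚ F : ℝ) * D.negAbsLogqDH) (h : P.Statement) : D.Cor312DHOn T' := by
  rw [D.cor312DHOn_iff_logvol hT' hT, negAbsLogqDHOn_eq_negAbsLogqDH D hT' hT]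
  have hF := FinDivisor.finrank_pos (F := F)
  have hle : ((P.negLogQ : ℝ) : WithTop ℝ) ≤
      (((Module.finrank ℚ F : ℝ) * D.negLogThetaDHOn T' : ℝ) : WithTop ℝ) := h.2.trans hΘ
  rw [WithTop.coe_le_coe, hq] at hle
  exact le_of_mul_le_mul_left hle hF

/-- Hence, under the same hypotheses, the printed statement gives Dupuy–Hilado (1.1) read with `Σ_p` over all
primes (`DHData.Cor312DHLim`). [cite: DupuyHilado2025, §1 (1.1)] -/
theorem cor312DHLim_of_statement_of_le (D : DHData F) {T' : Finset ℕ} (hT' : ∀ p ∈ T', p.Prime)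
    (hT : D.T ⊆ T')
    (hΘ : P.negLogTheta ≤ (((Module.finrank ℚ F : ℝ) * D.negLogThetaDHOn T' : ℝ) : WithTop ℝ))
    (hq : P.negLogQ = (Module.finrank ℚ F : ℝ) * D.negAbsLogqDH) (h : P.Statement) : D.Cor312DHLim :=
  D.cor312DHLim_of_cor312DHOn hT hT' (cor312DHOn_of_statement_of_le D hT' hT hΘ hq h)

/-- **(1.1) truncated to `T'` ⟹ printed statement, one-directional**: if c312-7's `−|log(Θ)|` is finite and AT
LEAST `[F:ℚ]·ln ν̄_{𝕃,T'}(hull(U_Θ))`, and the `q`-sides agree, then `D.Cor312DHOn T' → P.Statement`.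
[cite: DupuyHilado2025, §1 (1.1)] -/
theorem statement_of_cor312DHOn_of_le (D : DHData F) {T' : Finset ℕ} (hT' : ∀ p ∈ T', p.Prime)
    (hT : D.T ⊆ T') (hfin : P.negLogTheta ≠ ⊤)
    (hΘ : (((Module.finrank ℚ F : ℝ) * D.negLogThetaDHOn T' : ℝ) : WithTop ℝ) ≤ P.negLogTheta)
    (hq : P.negLogQ = (Module.finrank ℚ F : ℝ) * D.negAbsLogqDH) (h : D.Cor312DHOn T') : P.Statement := by
  rw [D.cor312DHOn_iff_logvol hT' hT, negAbsLogqDHOn_eq_negAbsLogqDH D hT' hT] at h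
  have hF := FinDivisor.finrank_pos (F := F)
  refine ⟨hfin, le_trans ?_ hΘ⟩
  rw [WithTop.coe_le_coe, hq]
  exact mul_le_mul_of_nonneg_left h hF.le

/-- By monotonicity in the prime set, the comparison over `T₀` gives the truncated (1.1) over every larger finite
prime set `T' ⊇ T₀ ⊇ T`. [cite: DupuyHilado2025, §1 (1.1)] -/
theorem cor312DHOn_of_statement_of_le_of_subset (D : DHData F) {T₀ T' : Finset ℕ} (h₀ : D.T ⊆ T₀)
    (h₀' : T₀ ⊆ T') (hT' : ∀ p ∈ T', p.Prime)
    (hΘ : P.negLogTheta ≤ (((Module.finrank ℚ F : ℝ) * D.negLogThetaDHOn T₀ : ℝ) : WithTop ℝ))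
    (hq : P.negLogQ = (Module.finrank ℚ F : ℝ) * D.negAbsLogqDH) (h : P.Statement) : D.Cor312DHOn T' :=
  D.cor312DHOn_mono h₀ h₀' hT' (cor312DHOn_of_statement_of_le D (fun p hp => hT' p (h₀' hp)) h₀ hΘ hq h)

/-- **Which truncation to name** (L6-t24's propagation (ii)): when the hull of `U_Θ` is supported on a finite prime
set `T₀` (`HullSupportedOn T₀`: [IUTchIV] Prop. 1.4 (iv) / Thm. 1.10 Step (vi) content, an obligation of the concrete
model), the comparison hypothesis `hΘ` does not depend on the finite prime set `T' ⊇ T₀` it is stated over — so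
the verbatim `−|log(Θ)|` is to be compared with the ONE number `[F:ℚ]·ln ν̄_{𝕃,T₀}(hull(U_Θ))` (= DH's `Σ_p`).
[cite: DupuyHilado2025, §1 p. 4, Def. 3.6.3] -/
theorem le_negLogThetaDHOn_iff_of_hullSupportedOn (D : DHData F) {T₀ T' : Finset ℕ}
    (hS : D.HullSupportedOn T₀) (h₀' : T₀ ⊆ T') (hT' : ∀ p ∈ T', p.Prime) :
    P.negLogTheta ≤ (((Module.finrank ℚ F : ℝ) * D.negLogThetaDHOn T' : ℝ) : WithTop ℝ) ↔
      P.negLogTheta ≤ (((Module.finrank ℚ F : ℝ) * D.negLogThetaDHOn T₀ : ℝ) : WithTop ℝ) := by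
  rw [D.negLogThetaDHOn_eq_of_hullSupportedOn hS h₀' hT']

/-! ## Normalized scale (RQ finding N-C8-1, seat abc-iut-c312-8, 2026-08-25T23:15Z)

SCALE NOTE. The printed `−|log(q)|` is a NORMALIZED quantity ([IUTchIV] Thm. 1.10 p. 23 "`|log(q)|` … is equal to
`(1/2l)·log(q)`" with `log(q)` the normalized arithmetic degree of [IUTchIV] Def. 1.9 (i); [IUTchIII] Rmk. 3.1.1 (ii)
normalized weights), as is Dupuy–Hilado's `ln ν̄_𝕃` (`deĝ̲ = deĝ/[F:ℚ]`, §2.5.4). The bridges above and in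
`Cor312FormsBridge` carry the factor `[F:ℚ]` because they compare c312-7's setting with c312-3's SKELETON setting
`DHData.toSetting`, whose `logvol` is `[F:ℚ]·ln ν̄_𝕃` (un-normalized, `LDHCor312Skel`); for a setting `P` attached to the same
initial Θ-data by c312-8's provenance links (`Cor312Prov.IsSettingOf`: `P.negLogQ = −absLogq = D.negAbsLogqDH`, no
factor — `Cor312ProvenanceScale.negLogQ_eq_negAbsLogqDH`, p411485) that `[F:ℚ]`-scaled `hq` is UNSATISFIABLE
(`finrank_ne_one_of_sqrt_neg_one`). The versions below compare at NORMALIZED scale — `P` directly with the DH numbers —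
and are the ones to use for provenance-attached pairs (their `hq` is then c312-8's theorem). [cite: DupuyHilado2025, §2.5.4]
-/

/-- **Printed statement ⟹ (1.1) truncated to `T'`, NORMALIZED scale**: if `−|log(Θ)| ≤ ln ν̄_{𝕃,T'}(hull(U_Θ))` (DH's
normalized log-volume, no `[F:ℚ]`) and `−|log(q)| = ln ν̄_𝕃(O_𝕃(−P_q)) = −deĝ̲(P_q)`, then `P.Statement → D.Cor312DHOn T'`.
[cite: DupuyHilado2025, §1 (1.1)] -/
theorem cor312DHOn_of_statement_of_le_norm (D : DHData F) {T' : Finset ℕ} (hT' : ∀ p ∈ T', p.Prime)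
    (hT : D.T ⊆ T') (hΘ : P.negLogTheta ≤ ((D.negLogThetaDHOn T' : ℝ) : WithTop ℝ))
    (hq : P.negLogQ = D.negAbsLogqDH) (h : P.Statement) : D.Cor312DHOn T' := by
  rw [D.cor312DHOn_iff_logvol hT' hT, negAbsLogqDHOn_eq_negAbsLogqDH D hT' hT, ← hq]
  exact WithTop.coe_le_coe.1 (h.2.trans hΘ)

/-- The case `T' = T`: `P.Statement → D.Cor312DH` at normalized scale. [cite: DupuyHilado2025, §1 (1.1)] -/
theorem cor312DH_of_statement_of_le_norm (D : DHData F) (hΘ : P.negLogTheta ≤ ((D.negLogThetaDH : ℝ) : WithTop ℝ))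
    (hq : P.negLogQ = D.negAbsLogqDH) (h : P.Statement) : D.Cor312DH :=
  (D.cor312DHOn_self_iff).1 (cor312DHOn_of_statement_of_le_norm D D.T_prime le_rfl hΘ hq h)

/-- Hence DH (1.1) with `Σ_p` (`Cor312DHLim`) at normalized scale. [cite: DupuyHilado2025, §1 (1.1)] -/
theorem cor312DHLim_of_statement_of_le_norm (D : DHData F) {T' : Finset ℕ} (hT' : ∀ p ∈ T', p.Prime)
    (hT : D.T ⊆ T') (hΘ : P.negLogTheta ≤ ((D.negLogThetaDHOn T' : ℝ) : WithTop ℝ))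
    (hq : P.negLogQ = D.negAbsLogqDH) (h : P.Statement) : D.Cor312DHLim :=
  D.cor312DHLim_of_cor312DHOn hT hT' (cor312DHOn_of_statement_of_le_norm D hT' hT hΘ hq h)

/-- **(1.1) truncated to `T'` ⟹ printed statement, NORMALIZED scale**: finiteness of `−|log(Θ)|`, the opposite
inequality `ln ν̄_{𝕃,T'}(hull(U_Θ)) ≤ −|log(Θ)|` and the normalized `q`-agreement give `D.Cor312DHOn T' → P.Statement`.
[cite: DupuyHilado2025, §1 (1.1)] -/
theorem statement_of_cor312DHOn_of_le_norm (D : DHData F) {T' : Finset ℕ} (hT' : ∀ p ∈ T', p.Prime)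
    (hT : D.T ⊆ T') (hfin : P.negLogTheta ≠ ⊤) (hΘ : ((D.negLogThetaDHOn T' : ℝ) : WithTop ℝ) ≤ P.negLogTheta)
    (hq : P.negLogQ = D.negAbsLogqDH) (h : D.Cor312DHOn T') : P.Statement := by
  rw [D.cor312DHOn_iff_logvol hT' hT, negAbsLogqDHOn_eq_negAbsLogqDH D hT' hT, ← hq] at h
  exact ⟨hfin, (WithTop.coe_le_coe.2 h).trans hΘ⟩

/-- The case `T' = T`: `D.Cor312DH → P.Statement` at normalized scale. [cite: DupuyHilado2025, §1 (1.1)] -/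
theorem statement_of_cor312DH_of_le_norm (D : DHData F) (hfin : P.negLogTheta ≠ ⊤)
    (hΘ : ((D.negLogThetaDH : ℝ) : WithTop ℝ) ≤ P.negLogTheta) (hq : P.negLogQ = D.negAbsLogqDH)
    (h : D.Cor312DH) : P.Statement :=
  statement_of_cor312DHOn_of_le_norm D D.T_prime le_rfl hfin hΘ hq ((D.cor312DHOn_self_iff).2 h)

/-- At normalized scale and with EQUALITY of the two `−|log(Θ)|` (finite) plus the normalized `q`-agreement, the printed
statement and DH (1.1) are EQUIVALENT — the normalized form of `Cor312FormsBridge.statement_iff_cor312DH`, without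
`BridgeHyps` and without the skeleton detour. [cite: DupuyHilado2025, §1 (1.1)] -/
theorem statement_iff_cor312DH_norm (D : DHData F) (hΘ : P.negLogTheta = ((D.negLogThetaDH : ℝ) : WithTop ℝ))
    (hq : P.negLogQ = D.negAbsLogqDH) : P.Statement ↔ D.Cor312DH :=
  ⟨cor312DH_of_statement_of_le_norm D hΘ.le hq,
    statement_of_cor312DH_of_le_norm D (hΘ ▸ WithTop.coe_ne_top) hΘ.ge hq⟩

end Cor312Vol

end IUTFork

end Summit.ABC

end
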